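import Mathlib
import Summits.KontsevichZagierPeriods.KontsevichZagierPeriods.Theorems.SoloInformedDivisionChain
import Summits.KontsevichZagierPeriods.KontsevichZagierPeriods.Theorems.SoloInformedDivisionMoveE
import Summits.KontsevichZagierPeriods.KontsevichZagierPeriods.Theorems.SoloInformedAlgebraicHull
import HarnessLib
import HarnessLib.Audit

/-!
# Division by translation VI: division chains tile `E(m)` up to Jacobi's zeta sum (solo-informed, s43)

Sixth file of LEMMA XXIX.1 KERNEL.  Along a division chain `(s_j)_{j ≤ q}` of part III the
incomplete integrals of the SECOND kind `E_p = [(0,s_p), e]`, `e(x) = (1 − m x²)κ(x)`, are tiled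
by translates of `E_1` up to the algebraic point classes produced by part V:

  `[E_p] + [pt, ζ_p] = p·[E_1]` in `P`,  `ζ_p = m·s_1·Σ_{j<p} s_j s_{j+1}`

(`soloInformed_divChain_tilingE`; model: `E(pK/q) + ζ_p = p·E(K/q)`, `ζ_p` = Jacobi's zeta sum),
hence `[E] + [pt, ζ_q] = q·[E_1]` and the `E_1`-free torsion identity
`q·([E_p] + [pt, ζ_p]) = p·([E] + [pt, ζ_q])` (`soloInformed_divChain_torsionE`).  Together with
part III (`q·[F_p] = p·[K]`) this is the input of THEOREM XXIX(i) KERNEL (part VII).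

References: C. G. J. Jacobi, *Fundamenta nova* (1829), §§53–55; N. H. Abel, *Recherches sur
les fonctions elliptiques*, Crelle 2–3 (1827–28), §§ V–VI; M. Kontsevich, D. Zagier, *Periods*
(2001), §1.2; this work (solo-informed s43).
-/

noncomputable section

open MeasureTheory Set Filter
open scoped Classical

open Literature.NumberTheory.Transcendental Literature.NumberTheory.Transcendental.KZ
open Literature.ModelTheory.ExponentialFields

namespace Summit.KontsevichZagierPeriods.KontsevichZagierPeriods.Theorems

/-! ### Jacobi's zeta sum along a chain -/

/-- **Jacobi's zeta sum** along a division chain: `ζ_p = m·s_1·Σ_{j<p} s_j s_{j+1}`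
(model: `ζ_p = p·E(K/q) − E(pK/q)`). [Jacobi 1829, §55] -/
def SoloInformedDivChain.zeta {m : ℝ} {q : ℕ} (c : SoloInformedDivChain m q) (p : ℕ) : ℝ :=
  m * c.s 1 * ∑ j ∈ Finset.range p, c.s j * c.s (j + 1)

/-- `ζ_0 = 0`. [this work] -/
theorem SoloInformedDivChain.zeta_zero {m : ℝ} {q : ℕ} (c : SoloInformedDivChain m q) :
    c.zeta 0 = 0 := by
  simp [SoloInformedDivChain.zeta]

/-- `ζ_{p+1} = ζ_p + m s_1 s_p s_{p+1}`. [this work] -/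
theorem SoloInformedDivChain.zeta_succ {m : ℝ} {q : ℕ} (c : SoloInformedDivChain m q) (p : ℕ) :
    c.zeta (p + 1) = c.zeta p + m * c.s 1 * (c.s p * c.s (p + 1)) := by
  simp only [SoloInformedDivChain.zeta, Finset.sum_range_succ]
  ring

/-- `ζ_1 = 0` (as `s_0 = 0`). [this work] -/
theorem SoloInformedDivChain.zeta_one {m : ℝ} {q : ℕ} (c : SoloInformedDivChain m q) :
    c.zeta 1 = 0 := by
  rw [c.zeta_succ 0, c.zeta_zero, c.s_zero]
  ring

/-- The zeta sums `ζ_p`, `p ≤ q`, are algebraic. [this work] -/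
theorem soloInformed_divChain_zeta_isAlgebraic {m : ℝ} {q : ℕ} (c : SoloInformedDivChain m q)
    (hm : m ∈ Ioo (0:ℝ) 1) (hma : IsAlgebraic ℚ m) : ∀ p, p ≤ q → IsAlgebraic ℚ (c.zeta p) := by
  intro p
  induction p with
  | zero => intro _; rw [c.zeta_zero]; exact isAlgebraic_zero
  | succ p ih =>
    intro hp1
    rw [c.zeta_succ]
    exact (ih (Nat.le_of_succ_le hp1)).add ((hma.mul c.one_isAlgebraic).mul
      ((soloInformed_divChain_mem c hm hma p (Nat.le_of_succ_le hp1)).2.mul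
        (soloInformed_divChain_mem c hm hma (p + 1) hp1).2))

/-- The point class of `0` vanishes. [Kontsevich–Zagier 2001, §1.2] -/
theorem soloInformed_pointRep_zero (h0 : IsAlgebraic ℚ (0:ℝ)) :
    toFormalPeriod (of (IntegralRep.unit.constMul 0 h0)) = 0 :=
  toFormalPeriod_eq_zero_iff.mpr (KZ.of_mem_relations_of_eqOn_zero _ fun z _ => by
    simp only [IntegralRep.integrand_constMul, zero_mul, Pi.zero_apply])

/-! ### The tiling theorem for the second kind -/

/-- **LEMMA XXIX.1-K (division by translation, second kind).**  For a division chain `(s_j)`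
of order `q` (modulus `0 < m < 1` algebraic), `E_1 = [(0,s_1), e]` and every `p ≤ q`: every
representation `[(0,s_p), e]` satisfies `[(0,s_p), e] + [pt, ζ_p] = p·[E_1]` in the formal period
ring — induction on `p`, splitting at `s_p`, translating `(0,s_1)` onto `(s_p, s_{p+1})` by
`soloInformed_addm_translation_moveE` and collecting the corrections `m s_1 s_p s_{p+1}` into
`ζ_{p+1} = ζ_p + m s_1 s_p s_{p+1}` on the point. [Jacobi 1829, §55; this work] -/
theorem soloInformed_divChain_tilingE {m : ℝ} {q : ℕ} (c : SoloInformedDivChain m q)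
    (hm : m ∈ Ioo (0:ℝ) 1) (hma : IsAlgebraic ℚ m) (E₁ : IntegralRep 1)
    (hE₁d : E₁.domain = {x | x 0 ∈ Ioo (0:ℝ) (c.s 1)})
    (hE₁i : EqOn E₁.integrand
      (fun x => (1 - m * x 0 ^ 2) * ((√(1 - x 0 ^ 2))⁻¹ * (√(1 - m * x 0 ^ 2))⁻¹)) E₁.domain) :
    ∀ p, p ≤ q → ∀ G : IntegralRep 1, G.domain = {x | x 0 ∈ Ioo (0:ℝ) (c.s p)} →
      EqOn G.integrand
        (fun x => (1 - m * x 0 ^ 2) * ((√(1 - x 0 ^ 2))⁻¹ * (√(1 - m * x 0 ^ 2))⁻¹)) G.domain →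
      ∀ hz : IsAlgebraic ℚ (c.zeta p),
        toFormalPeriod (of G) + toFormalPeriod (of (IntegralRep.unit.constMul (c.zeta p) hz)) =
          (p : FormalPeriodRing) * toFormalPeriod (of E₁) := by
  intro p
  induction p with
  | zero =>
    intro _ G hGd _
    rw [c.zeta_zero]
    intro hz
    have hvol : volume G.domain = 0 := by
      rw [hGd, c.s_zero]
      simp only [Ioo_self, mem_empty_iff_false, setOf_false, measure_empty]
    rw [Nat.cast_zero, zero_mul, soloInformed_pointRep_zero, add_zero, toFormalPeriod_eq_zero_iff]
    exact KZ.of_mem_relations_of_volume_eq_zero G hvol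
  | succ p ih =>
    intro hp1 G hGd hGi
    have hp : p < q := hp1
    rcases Nat.eq_zero_or_pos p with rfl | hp0
    · rw [Nat.zero_add, c.zeta_one]
      intro hz
      have h : of G - of E₁ ∈ relations :=
        KZ.of_sub_of_mem_relations_of_eqOn (by rw [hE₁d, hGd]) fun x hx =>
          (hGi hx).trans (hE₁i (by rw [hE₁d]; rw [hGd] at hx; exact hx)).symm
      rw [toFormalPeriod_eq_iff.mpr h, soloInformed_pointRep_zero, add_zero, Nat.cast_one, one_mul]
    · rw [c.zeta_succ p]
      intro hz
      obtain ⟨hIp, hpa⟩ := soloInformed_divChain_mem c hm hma p hp.le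
      obtain ⟨-, hp1a⟩ := soloInformed_divChain_mem c hm hma (p + 1) hp1
      have hs1 : c.s 1 ∈ Ioo (0:ℝ) 1 :=
        ⟨c.one_pos, soloInformed_divChain_lt_one c hm hma (lt_of_le_of_lt hp0 hp)⟩
      have hlt : c.s p < c.s (p + 1) := soloInformed_divChain_lt_succ c hm hma hp
      have hzp := soloInformed_divChain_zeta_isAlgebraic c hm hma p hp.le
      have hcp : IsAlgebraic ℚ (m * c.s 1 * (c.s p * c.s (p + 1))) :=
        (hma.mul c.one_isAlgebraic).mul (hpa.mul hp1a)
      obtain ⟨G₁, G₂, hG₁d, hG₂d, hG₁i, hG₂i, hsplit⟩ :=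
        soloInformed_slab_split G hIp.1 hlt.le isAlgebraic_zero hpa hp1a hGd
      have h1 : toFormalPeriod (of G₁) +
          toFormalPeriod (of (IntegralRep.unit.constMul (c.zeta p) hzp)) =
          (p : FormalPeriodRing) * toFormalPeriod (of E₁) := by
        refine ih hp.le G₁ hG₁d (fun x hx => ?_) hzp
        rw [hG₁i]
        refine hGi ?_
        rw [hGd]; rw [hG₁d] at hx
        exact ⟨hx.1, hx.2.trans hlt⟩
      have h2 : of G₂ + of (IntegralRep.unit.constMul _ hcp) - of E₁ ∈ relations := by
        refine soloInformed_addm_translation_moveE hm hma hIp hpa hs1 c.one_isAlgebraic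
          (c.turn p hp) E₁ G₂ hE₁d (by rw [hG₂d, c.step p hp]) hE₁i (fun x hx => ?_) hcp ?_
        · rw [hG₂i]
          refine hGi ?_
          rw [hGd]; rw [hG₂d] at hx
          exact ⟨hIp.1.trans_lt hx.1, hx.2⟩
        · rw [c.step p hp]; ring
      have e1 : toFormalPeriod (of G) = toFormalPeriod (of G₁) + toFormalPeriod (of G₂) := by
        rw [← map_add, toFormalPeriod_eq_iff]
        convert hsplit using 1
        abel
      have e2 := soloInformed_pointRep_add _ _ hzp hcp hz
      have e3 : toFormalPeriod (of G₂) + toFormalPeriod (of (IntegralRep.unit.constMul _ hcp)) =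
          toFormalPeriod (of E₁) := by
        rw [← map_add]
        exact toFormalPeriod_eq_iff.mpr h2
      rw [e1, ← e2, Nat.cast_succ]
      linear_combination h1 + e3

/-- **`[E(m)] + [pt, ζ_q] = q·[E_1]` in `P`** for a division chain of order `q`. [this work] -/
theorem soloInformed_divChain_periodE {m : ℝ} {q : ℕ} (c : SoloInformedDivChain m q)
    (hm : m ∈ Ioo (0:ℝ) 1) (hma : IsAlgebraic ℚ m) (E E₁ : IntegralRep 1)
    (hEd : E.domain = {x | x 0 ∈ Ioo (0:ℝ) 1})
    (hEi : EqOn E.integrand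
      (fun x => (1 - m * x 0 ^ 2) * ((√(1 - x 0 ^ 2))⁻¹ * (√(1 - m * x 0 ^ 2))⁻¹)) E.domain)
    (hE₁d : E₁.domain = {x | x 0 ∈ Ioo (0:ℝ) (c.s 1)})
    (hE₁i : EqOn E₁.integrand
      (fun x => (1 - m * x 0 ^ 2) * ((√(1 - x 0 ^ 2))⁻¹ * (√(1 - m * x 0 ^ 2))⁻¹)) E₁.domain)
    (hz : IsAlgebraic ℚ (c.zeta q)) :
    toFormalPeriod (of E) + toFormalPeriod (of (IntegralRep.unit.constMul (c.zeta q) hz)) =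
      (q : FormalPeriodRing) * toFormalPeriod (of E₁) :=
  soloInformed_divChain_tilingE c hm hma E₁ hE₁d hE₁i q le_rfl E (by rw [hEd, c.top]) hEi hz

/-- **`q·([E_p] + [pt, ζ_p]) = p·([E] + [pt, ζ_q])` in `P`**: the second-kind torsion identity
along a division chain, free of `E_1`. [this work] -/
theorem soloInformed_divChain_torsionE {m : ℝ} {q : ℕ} (c : SoloInformedDivChain m q)
    (hm : m ∈ Ioo (0:ℝ) 1) (hma : IsAlgebraic ℚ m) (E Ep : IntegralRep 1) {p : ℕ} (hp : p ≤ q)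
    (hEd : E.domain = {x | x 0 ∈ Ioo (0:ℝ) 1})
    (hEi : EqOn E.integrand
      (fun x => (1 - m * x 0 ^ 2) * ((√(1 - x 0 ^ 2))⁻¹ * (√(1 - m * x 0 ^ 2))⁻¹)) E.domain)
    (hEpd : Ep.domain = {x | x 0 ∈ Ioo (0:ℝ) (c.s p)})
    (hEpi : EqOn Ep.integrand
      (fun x => (1 - m * x 0 ^ 2) * ((√(1 - x 0 ^ 2))⁻¹ * (√(1 - m * x 0 ^ 2))⁻¹)) Ep.domain)
    (hzq : IsAlgebraic ℚ (c.zeta q)) (hzp : IsAlgebraic ℚ (c.zeta p)) :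
    (q : FormalPeriodRing) * (toFormalPeriod (of Ep) +
        toFormalPeriod (of (IntegralRep.unit.constMul (c.zeta p) hzp))) =
      (p : FormalPeriodRing) * (toFormalPeriod (of E) +
        toFormalPeriod (of (IntegralRep.unit.constMul (c.zeta q) hzq))) := by
  obtain ⟨E₀, hE₀d, hE₀i⟩ := soloInformed_exists_ellipticE_rep m hm hma
  have hSA : IsSemialgebraic ℚ {x : Fin 1 → ℝ | x 0 ∈ Ioo (0:ℝ) (c.s 1)} :=
    (isSemialgebraic_setOf_const_lt_apply isAlgebraic_zero 0).inter
      (isSemialgebraic_setOf_apply_lt_const c.one_isAlgebraic 0)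
  have hsub : {x : Fin 1 → ℝ | x 0 ∈ Ioo (0:ℝ) (c.s 1)} ⊆ E₀.domain := fun x hx => by
    rw [hE₀d]; exact ⟨hx.1, hx.2.trans_le c.one_le⟩
  have hF := soloInformed_divChain_tilingE c hm hma (E₀.restrict _ hSA hsub) rfl
    (fun x _ => hE₀i x)
  rw [hF p hp Ep hEpd hEpi hzp, hF q le_rfl E (by rw [hEd, c.top]) hEi hzq]
  ring

/-- **Existence of the incomplete representations `E_p = [(0,s_p), e]`** along a chain
(restrictions of `E(m)`). [this work] -/
theorem soloInformed_exists_divChain_repE {m : ℝ} {q : ℕ} (c : SoloInformedDivChain m q)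
    (hm : m ∈ Ioo (0:ℝ) 1) (hma : IsAlgebraic ℚ m) {p : ℕ} (hp : p ≤ q) :
    ∃ Ep : IntegralRep 1, Ep.domain = {x | x 0 ∈ Ioo (0:ℝ) (c.s p)} ∧
      ∀ x, Ep.integrand x = (1 - m * x 0 ^ 2) * ((√(1 - x 0 ^ 2))⁻¹ * (√(1 - m * x 0 ^ 2))⁻¹) := by
  obtain ⟨E₀, hE₀d, hE₀i⟩ := soloInformed_exists_ellipticE_rep m hm hma
  obtain ⟨hI, hpa⟩ := soloInformed_divChain_mem c hm hma p hp
  have hSA : IsSemialgebraic ℚ {x : Fin 1 → ℝ | x 0 ∈ Ioo (0:ℝ) (c.s p)} :=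
    (isSemialgebraic_setOf_const_lt_apply isAlgebraic_zero 0).inter
      (isSemialgebraic_setOf_apply_lt_const hpa 0)
  have hsub : {x : Fin 1 → ℝ | x 0 ∈ Ioo (0:ℝ) (c.s p)} ⊆ E₀.domain := fun x hx => by
    rw [hE₀d]; exact ⟨hx.1, hx.2.trans_le hI.2⟩
  exact ⟨E₀.restrict _ hSA hsub, rfl, fun x => hE₀i x⟩

end Summit.KontsevichZagierPeriods.KontsevichZagierPeriods.Theorems

end
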